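/-
Copyright (c) 2026. All rights reserved.
Released under Apache 2.0 license as described in the file LICENSE.
Authors: solo-Langlands-informed (ideation tier, family 6).
-/
import Literature.NumberTheory.GaloisRepresentations.LabelledWeightsTateTwist
import Literature.NumberTheory.GaloisRepresentations.LabelFilDTransport
import HarnessLib

/-!
# Twisting by a character with coefficients shifts the labelled Hodge filtration

Topic `NumberTheory/GaloisRepresentations`; namespace
`Literature.NumberTheory.GaloisRepresentations.PeriodRingData`.  Theorems and two auxiliary
definitions (no named fact, no `sorry`).  Companion of the accepted `LabelledWeightsTateTwist`, which
treats twists by characters `θ : Γ → P` having a period `u ∈ B` (`u = θ(σ) σ(u)`): there the map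
`id ⊗ (u ·)` carries `Fil^{i+k} D_τ(ρ)` onto `Fil^i D_τ(θρ)`.  A character `χ : Γ → E×` with values in
the COEFFICIENT field has no period in `B`; its period lives in the coefficient period ring
`R = E ⊗_P B` (here `(Fin 1 → E) ⊗_P B`, the ambient space of `D(χ)` for the rank-one representation
`c ↦ χ(σ) c` on `Fin 1 → E`), namely any generator `d` of the line `D_τ(χ) ⊆ R`.  This file sets up the
action of `R` on `M ⊗_P B` and proves the ABSTRACT TWISTING THEOREM (Fontaine 1994, Exp. III §1.5 and
Prop. 1.5.2: `D` with coefficients is a `⊗`-functor embedding by embedding; Patrikis 2019, §2.3.1 and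
§2.7.1: `HT_τ(ρ ⊗ χ) = HT_τ(ρ) + HT_τ(χ)`):

* `baseActBAlgHom` — `b ↦ id ⊗ (b ·)` as a `P`-algebra map `B → End_E (M ⊗_P B)` (accepted `baseActB`);
* `perMul` — **the action of the coefficient period ring** `(Fin 1 → E) ⊗_P B` on `M ⊗_P B`,
  `c ⊗ b ↦ (c 0) • (id ⊗ (b ·))`, an `E`-algebra homomorphism; it commutes with the `F`-action
  (`baseAct_perMul`), is multiplicative for the filtration pieces `M ⊗ Fil^•`
  (`perMul_mem_coeffFilTensor`), and intertwines the diagonal actions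
  (`coeffTensorRep_perMul`: `σ_{ρ'} ∘ perMul d = perMul (σ_{χ} d) ∘ σ_ρ` when `ρ' = χ · ρ`);
  on `R` itself it is the multiplication (`perMul_apply_eq_mul`);
* `labelFilD_equiv_of_twistUnit` — **if `d ∈ D(χ) ∩ (E ⊗ Fil^k B)` admits `u ∈ E ⊗ Fil^{-k} B` with
  `u · d` acting as the identity on the `τ`-isotypic part `{x | (1 ⊗ f) x = τ(f) x}` of `M ⊗_P B`**
  (for `B_dR`: `d` a generator of the line `D_τ(χ)` with `HT_τ(χ) = {k}`, `u` the inverse of `d` in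
  the `τ`-corner of `E ⊗ B_dR`), then `x ↦ perMul d x` is an `E`-linear isomorphism
  `Fil^i D_τ(ρ) ≃ Fil^{i+k} D_τ(χρ)` for every `i` and every `E`-linear `ρ` on `M` (no admissibility
  or finiteness needed), whence
* `labelledHodgeTateWeights_of_twistUnit` — `HT_τ(χ · ρ) = HT_τ(ρ) + k` (multisets translated by `k`).

The existence of such `(d, u)` for `B_dR(K)` and de Rham `χ` (a computation in
`E ⊗_{ℚ_p} B_dR ≅ ∏_{E → K̄} B_dR` using that `Γ_K` permutes the embeddings over a given label
transitively) is proved separately; this file is pure period-ring algebra.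

## References
* [FontaineAsterisque223III] J.-M. Fontaine, *Représentations p-adiques semi-stables*, Astérisque 223
  (1994), Exp. III §1.5, Prop. 1.5.2.
* [Patrikis2019] S. Patrikis, *Variations on a theorem of Tate*, Mem. AMS 258 (2019), §2.3.1, §2.7.1.
* [BrinonConrad2009] O. Brinon, B. Conrad, *CMI Summer School notes on p-adic Hodge theory* (2009),
  §6.3 (`D_dR` is a `⊗`-functor; twists).
-/

noncomputable section

open scoped TensorProduct
open TensorProduct

namespace Literature.NumberTheory.GaloisRepresentations

namespace PeriodRingData

universe u v v' w

-- Mathlib's own global value of `maxSynthPendingDepth` (see `LabelledWeightsTwist`); the large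
-- tensor types also need a higher instance-synthesis budget.
set_option maxSynthPendingDepth 3
set_option synthInstance.maxHeartbeats 200000

section PerMul

variable {Γ : Type u} [Group Γ] {P : Type v} {F : Type v'} [Field P] [Field F] [Algebra P F]
  (E : Type*) [Field E] [Algebra P E]
  (M : Type*) [AddCommGroup M] [Module E M] [Module P M] [IsScalarTower P E M]
  (𝔅 : PeriodRingData.{u, v, v', w} Γ P F)

/-- **`b ↦ id ⊗ (b ·)` as a `P`-algebra homomorphism `B → End_E (M ⊗_P B)`** (the accepted
`baseActB`, bundled). [cite: FontaineAsterisque223III, Exp. III §1.5] -/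
def baseActBAlgHom : 𝔅.B →ₐ[P] Module.End E (M ⊗[P] 𝔅.B) where
  toFun b := 𝔅.baseActB E M b
  map_one' := LinearMap.ext fun x => 𝔅.baseActB_one x
  map_mul' b c := LinearMap.ext fun x => 𝔅.baseActB_mul b c x
  map_zero' := by
    refine TensorProduct.AlgebraTensorModule.ext fun m b => ?_
    rw [baseActB_tmul, zero_mul, tmul_zero, LinearMap.zero_apply]
  map_add' b c := by
    refine TensorProduct.AlgebraTensorModule.ext fun m b' => ?_
    rw [baseActB_tmul, LinearMap.add_apply, baseActB_tmul, baseActB_tmul, add_mul, tmul_add]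
  commutes' c := by
    refine TensorProduct.AlgebraTensorModule.ext fun m b => ?_
    rw [baseActB_tmul, Module.algebraMap_end_apply, ← Algebra.smul_def, TensorProduct.smul_tmul',
      TensorProduct.smul_tmul]

/-- Unfolding lemma for `baseActBAlgHom`. [cite: FontaineAsterisque223III, Exp. III §1.5] -/
@[simp] theorem baseActBAlgHom_apply (b : 𝔅.B) : 𝔅.baseActBAlgHom E M b = 𝔅.baseActB E M b := rfl

/-- **The action of the coefficient period ring `(Fin 1 → E) ⊗_P B` on `M ⊗_P B`**:
`c ⊗ b ↦ (c 0) • (id ⊗ (b ·))`, an `E`-algebra homomorphism (the `E ⊗_P B`-module structure of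
`M ⊗_P B = (M ⊗_E E) ⊗_P B`; Fontaine's `D` with coefficients in `E` is an `E ⊗_P B^Γ`-module and the
comparison map is `E ⊗_P B`-linear). [cite: FontaineAsterisque223III, Exp. III §1.5]
[cite: Patrikis2019, §2.7.1] -/
def perMul : (Fin 1 → E) ⊗[P] 𝔅.B →ₐ[E] Module.End E (M ⊗[P] 𝔅.B) :=
  Algebra.TensorProduct.lift
    ((Algebra.ofId E (Module.End E (M ⊗[P] 𝔅.B))).comp (Pi.evalAlgHom E (fun _ : Fin 1 => E) 0))
    (𝔅.baseActBAlgHom E M) (fun c b => Algebra.commutes (c 0) (𝔅.baseActB E M b))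

/-- `perMul` on pure tensors: `(c ⊗ b) · x = (c 0) • (id ⊗ (b ·)) x`. [cite: FontaineAsterisque223III, Exp. III §1.5] -/
theorem perMul_tmul_apply (c : Fin 1 → E) (b : 𝔅.B) (x : M ⊗[P] 𝔅.B) :
    𝔅.perMul E M (c ⊗ₜ[P] b) x = c 0 • 𝔅.baseActB E M b x := by
  rw [perMul, Algebra.TensorProduct.lift_tmul, Module.End.mul_apply]
  rfl

/-- `(1 ⊗ b) · x = (id ⊗ (b ·)) x`. [cite: FontaineAsterisque223III, Exp. III §1.5] -/
theorem perMul_one_tmul_apply (b : 𝔅.B) (x : M ⊗[P] 𝔅.B) :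
    𝔅.perMul E M ((1 : Fin 1 → E) ⊗ₜ[P] b) x = 𝔅.baseActB E M b x := by
  rw [perMul_tmul_apply, Pi.one_apply, one_smul]

/-- **`perMul` commutes with the `F`-action** `id ⊗ (f • ·)` (`B` is commutative). [cite: FontaineAsterisque223III, Exp. III §1.5] -/
theorem baseAct_perMul (f : F) (d : (Fin 1 → E) ⊗[P] 𝔅.B) (x : M ⊗[P] 𝔅.B) :
    𝔅.baseAct E M f (𝔅.perMul E M d x) = 𝔅.perMul E M d (𝔅.baseAct E M f x) := by
  induction d using TensorProduct.induction_on with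
  | zero => rw [map_zero, LinearMap.zero_apply, LinearMap.zero_apply, map_zero]
  | tmul c b => rw [perMul_tmul_apply, perMul_tmul_apply, map_smul, baseActB_baseAct]
  | add y z hy hz => rw [map_add, LinearMap.add_apply, LinearMap.add_apply, map_add, hy, hz]

/-- **`perMul` is multiplicative for the filtration pieces**:
`(E ⊗ Fil^a B) · (M ⊗ Fil^i B) ⊆ M ⊗ Fil^{a+i} B`. [cite: FontaineAsterisque223III, Exp. III §1.5] -/
theorem perMul_mem_coeffFilTensor {a i : ℤ} {d : (Fin 1 → E) ⊗[P] 𝔅.B}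
    (hd : d ∈ 𝔅.coeffFilTensor E (Fin 1 → E) a) {x : M ⊗[P] 𝔅.B}
    (hx : x ∈ 𝔅.coeffFilTensor E M i) : 𝔅.perMul E M d x ∈ 𝔅.coeffFilTensor E M (a + i) := by
  refine 𝔅.coeffFilTensor_induction (E := E) (M := Fin 1 → E)
    (C := fun d => 𝔅.perMul E M d x ∈ 𝔅.coeffFilTensor E M (a + i)) ?_ (fun c b hb => ?_)
    (fun y z hy hz => ?_) hd
  · rw [map_zero, LinearMap.zero_apply]; exact zero_mem _
  · refine 𝔅.coeffFilTensor_induction (E := E) (M := M)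
      (C := fun x => 𝔅.perMul E M (c ⊗ₜ[P] b) x ∈ 𝔅.coeffFilTensor E M (a + i)) ?_ (fun m b' hb' => ?_)
      (fun y z hy hz => ?_) hx
    · rw [map_zero]; exact zero_mem _
    · rw [perMul_tmul_apply, baseActB_tmul]
      exact Submodule.smul_mem _ _ (𝔅.tmul_mem_coeffFilTensor m (𝔅.mul_mem_fil a i b b' hb hb'))
    · rw [map_add]; exact add_mem hy hz
  · rw [map_add, LinearMap.add_apply]; exact add_mem hy hz

/-- **On the coefficient period ring itself `perMul` is the multiplication.** [cite: FontaineAsterisque223III, Exp. III §1.5] -/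
theorem perMul_apply_eq_mul (d x : (Fin 1 → E) ⊗[P] 𝔅.B) : 𝔅.perMul E (Fin 1 → E) d x = d * x := by
  induction d using TensorProduct.induction_on with
  | zero => rw [map_zero, LinearMap.zero_apply, zero_mul]
  | tmul c b =>
    induction x using TensorProduct.induction_on with
    | zero => rw [map_zero, mul_zero]
    | tmul c' b' =>
      rw [perMul_tmul_apply, baseActB_tmul, Algebra.TensorProduct.tmul_mul_tmul, TensorProduct.smul_tmul']
      congr 1
      funext i
      rw [Pi.smul_apply, smul_eq_mul, Pi.mul_apply, Subsingleton.elim i 0]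
    | add y z hy hz => rw [map_add, mul_add, hy, hz]
  | add y z hy hz => rw [map_add, LinearMap.add_apply, add_mul, hy, hz]

/-- **The filtration pieces of the coefficient period ring are multiplicative**:
`(E ⊗ Fil^a B) · (E ⊗ Fil^i B) ⊆ E ⊗ Fil^{a+i} B`. [cite: FontaineAsterisque223III, Exp. III §1.5] -/
theorem mul_mem_coeffFilTensor {a i : ℤ} {d x : (Fin 1 → E) ⊗[P] 𝔅.B}
    (hd : d ∈ 𝔅.coeffFilTensor E (Fin 1 → E) a) (hx : x ∈ 𝔅.coeffFilTensor E (Fin 1 → E) i) :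
    d * x ∈ 𝔅.coeffFilTensor E (Fin 1 → E) (a + i) := by
  rw [← perMul_apply_eq_mul]
  exact 𝔅.perMul_mem_coeffFilTensor E (Fin 1 → E) hd hx

end PerMul

/-! ### Equivariance and the abstract twisting theorem -/

section Twist

variable {Γ : Type u} [Group Γ] [TopologicalSpace Γ] {P : Type v} {F : Type v'} [Field P]
  [Field F] [Algebra P F]
  {E : Type*} [Field E] [Algebra P E] [TopologicalSpace E]
  {M : Type*} [AddCommGroup M] [Module E M] [Module P M] [IsScalarTower P E M]
  [TopologicalSpace M]
  (𝔅 : PeriodRingData.{u, v, v', w} Γ P F)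
  (a : Γ → E) (χ₁ : ContinuousRep Γ E (Fin 1 → E)) (ρ ρ' : ContinuousRep Γ E M)

/-- **`perMul` intertwines the diagonal actions**: if `χ₁(σ) c = a(σ) c` on `Fin 1 → E` and
`ρ'(σ) = a(σ) ρ(σ)`, then `σ_{ρ'} (d · x) = (σ_{χ₁} d) · (σ_ρ x)`.
[cite: FontaineAsterisque223III, Exp. III Prop. 1.5.2] -/
theorem coeffTensorRep_perMul (hχ₁ : ∀ σ c, χ₁ σ c = a σ • c) (hρ' : ∀ σ m, ρ' σ m = a σ • ρ σ m)
    (σ : Γ) (d : (Fin 1 → E) ⊗[P] 𝔅.B) (x : M ⊗[P] 𝔅.B) :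
    𝔅.coeffTensorRep ρ' σ (𝔅.perMul E M d x) =
      𝔅.perMul E M (𝔅.coeffTensorRep χ₁ σ d) (𝔅.coeffTensorRep ρ σ x) := by
  induction d using TensorProduct.induction_on with
  | zero => simp only [map_zero, LinearMap.zero_apply]
  | tmul c b =>
    induction x using TensorProduct.induction_on with
    | zero => rw [map_zero, map_zero, map_zero, map_zero]
    | tmul m b' =>
      rw [perMul_tmul_apply, baseActB_tmul, map_smul, coeffTensorRep_apply_tmul, coeffTensorRep_apply_tmul,
        coeffTensorRep_apply_tmul, perMul_tmul_apply, baseActB_tmul, hρ', hχ₁, Pi.smul_apply, smul_eq_mul,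
        smul_mul', ← TensorProduct.smul_tmul', smul_smul, mul_comm]
    | add y z hy hz => rw [map_add, map_add, hy, hz, map_add, map_add]
  | add y z hy hz =>
    rw [map_add, LinearMap.add_apply, map_add, hy, hz, map_add, map_add, LinearMap.add_apply]

variable (τ : F →+* E) (k : ℤ)

/-- **The abstract twisting theorem.**  Let `χ₁(σ) c = a(σ) c` on `Fin 1 → E`, `ρ' = a · ρ` on `M`,
`d ∈ D(χ₁) ∩ ((Fin 1 → E) ⊗ Fil^k B)` and `u ∈ (Fin 1 → E) ⊗ Fil^{-k} B` with `u · d` acting as the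
identity on the `τ`-isotypic part `{x | (id ⊗ f) x = τ(f) x for all f ∈ F}` of `M ⊗_P B`.  Then
`x ↦ d · x` is an `E`-linear isomorphism **`Fil^i D_τ(ρ) ≃ Fil^{i+k} D_τ(ρ')`** with inverse
`y ↦ u · y`, for every `i`. [cite: FontaineAsterisque223III, Exp. III Prop. 1.5.2]
[cite: Patrikis2019, §2.3.1 and §2.7.1] -/
theorem labelFilD_equiv_of_twistUnit (hχ₁ : ∀ σ c, χ₁ σ c = a σ • c)
    (hρ' : ∀ σ m, ρ' σ m = a σ • ρ σ m) {d u : (Fin 1 → E) ⊗[P] 𝔅.B} (hdD : d ∈ 𝔅.coeffD χ₁)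
    (hdk : d ∈ 𝔅.coeffFilTensor E (Fin 1 → E) k) (huk : u ∈ 𝔅.coeffFilTensor E (Fin 1 → E) (-k))
    (hud : ∀ x : M ⊗[P] 𝔅.B, (∀ f : F, 𝔅.baseAct E M f x = τ f • x) → 𝔅.perMul E M (u * d) x = x)
    (i : ℤ) : Nonempty (𝔅.labelFilD ρ τ i ≃ₗ[E] 𝔅.labelFilD ρ' τ (i + k)) := by
  -- `perMul` preserves the `τ`-isotypic part
  have hiso : ∀ (e : (Fin 1 → E) ⊗[P] 𝔅.B) (x : M ⊗[P] 𝔅.B), (∀ f : F, 𝔅.baseAct E M f x = τ f • x) →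
      ∀ f : F, 𝔅.baseAct E M f (𝔅.perMul E M e x) = τ f • 𝔅.perMul E M e x := by
    intro e x hx f
    rw [baseAct_perMul, hx f, map_smul]
  -- the isotypic part is stable under the diagonal action
  have hisoσ : ∀ (x : M ⊗[P] 𝔅.B), (∀ f : F, 𝔅.baseAct E M f x = τ f • x) →
      ∀ (σ : Γ) (f : F), 𝔅.baseAct E M f (𝔅.coeffTensorRep ρ σ x) = τ f • 𝔅.coeffTensorRep ρ σ x := by
    intro x hx σ f
    rw [baseAct_comm, hx f, map_smul]
  -- `d ·` maps `Fil^i D_τ(ρ)` into `Fil^{i+k} D_τ(ρ')`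
  have hD : ∀ x ∈ 𝔅.labelFilD ρ τ i, 𝔅.perMul E M d x ∈ 𝔅.labelFilD ρ' τ (i + k) := by
    intro x hx
    obtain ⟨⟨hxD, hxτ⟩, hxi⟩ := Submodule.mem_inf.1 hx
    refine Submodule.mem_inf.2 ⟨⟨fun σ => ?_, hiso d x hxτ⟩, ?_⟩
    · rw [𝔅.coeffTensorRep_perMul a χ₁ ρ ρ' hχ₁ hρ', hdD σ, hxD σ]
    · rw [add_comm]; exact 𝔅.perMul_mem_coeffFilTensor E M hdk hxi
  -- `u ·` maps `Fil^{i+k} D_τ(ρ')` into `Fil^i D_τ(ρ)`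
  have hU : ∀ y ∈ 𝔅.labelFilD ρ' τ (i + k), 𝔅.perMul E M u y ∈ 𝔅.labelFilD ρ τ i := by
    intro y hy
    obtain ⟨⟨hyD, hyτ⟩, hyi⟩ := Submodule.mem_inf.1 hy
    have hxτ := hiso u y hyτ
    -- `d · (u · y) = y`
    have hdy : 𝔅.perMul E M d (𝔅.perMul E M u y) = y := by
      rw [← Module.End.mul_apply, ← map_mul, mul_comm, hud y hyτ]
    refine Submodule.mem_inf.2 ⟨⟨fun σ => ?_, hxτ⟩, ?_⟩
    · -- invariance of `x = u · y`: `d · (σ x) = σ (d · x) = σ y = y = d · x`, then apply `u ·`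
      have h1 : 𝔅.perMul E M d (𝔅.coeffTensorRep ρ σ (𝔅.perMul E M u y)) = y := by
        have h := 𝔅.coeffTensorRep_perMul a χ₁ ρ ρ' hχ₁ hρ' σ d (𝔅.perMul E M u y)
        rw [hdD σ, hdy, hyD σ] at h
        exact h.symm
      rw [← hud _ (hisoσ _ hxτ σ), map_mul, Module.End.mul_apply, h1]
    · have h := 𝔅.perMul_mem_coeffFilTensor E M huk hyi
      rwa [show -k + (i + k) = i by omega] at h
  refine ⟨LinearEquiv.ofLinear ((𝔅.perMul E M d).restrict hD) ((𝔅.perMul E M u).restrict hU) ?_ ?_⟩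
  · refine LinearMap.ext fun y => Subtype.ext ?_
    change 𝔅.perMul E M d (𝔅.perMul E M u y) = y
    rw [← Module.End.mul_apply, ← map_mul, mul_comm, hud y (Submodule.mem_inf.1 y.2).1.2]
  · refine LinearMap.ext fun x => Subtype.ext ?_
    change 𝔅.perMul E M u (𝔅.perMul E M d x) = x
    rw [← Module.End.mul_apply, ← map_mul, hud x (Submodule.mem_inf.1 x.2).1.2]

/-- **Twisting by a character with an exact `τ`-period of weight `k` translates the `τ`-labelled
Hodge–Tate weights by `k`**: under the hypotheses of `labelFilD_equiv_of_twistUnit`,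
`HT_τ(ρ') = HT_τ(ρ) + k` as multisets (Patrikis: `HT_τ(ρ ⊗ χ) = {h + HT_τ(χ) | h ∈ HT_τ(ρ)}`).
[cite: Patrikis2019, §2.3.1 and §2.7.1] [cite: FontaineAsterisque223III, Exp. III Prop. 1.5.2] -/
theorem labelledHodgeTateWeights_of_twistUnit (hχ₁ : ∀ σ c, χ₁ σ c = a σ • c)
    (hρ' : ∀ σ m, ρ' σ m = a σ • ρ σ m) {d u : (Fin 1 → E) ⊗[P] 𝔅.B} (hdD : d ∈ 𝔅.coeffD χ₁)
    (hdk : d ∈ 𝔅.coeffFilTensor E (Fin 1 → E) k) (huk : u ∈ 𝔅.coeffFilTensor E (Fin 1 → E) (-k))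
    (hud : ∀ x : M ⊗[P] 𝔅.B, (∀ f : F, 𝔅.baseAct E M f x = τ f • x) → 𝔅.perMul E M (u * d) x = x) :
    𝔅.labelledHodgeTateWeights ρ' τ = (𝔅.labelledHodgeTateWeights ρ τ).map (· + k) := by
  have hfin : ∀ j, Module.finrank E (𝔅.labelFilD ρ' τ j) =
      Module.finrank E (𝔅.labelFilD ρ τ (j + -k)) := by
    intro j
    obtain ⟨e⟩ := 𝔅.labelFilD_equiv_of_twistUnit a χ₁ ρ ρ' τ k hχ₁ hρ' hdD hdk huk hud (j + -k)
    have h := e.finrank_eq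
    rw [neg_add_cancel_right] at h
    exact h.symm
  have hfun : (fun j => Module.finrank E (𝔅.labelFilD ρ' τ j)) =
      fun j => (fun i => Module.finrank E (𝔅.labelFilD ρ τ i)) (j + -k) := funext hfin
  rw [labelledHodgeTateWeights_def, labelledHodgeTateWeights_def, hfun,
    jumpMultiset_comp_add (fun i => Module.finrank E (𝔅.labelFilD ρ τ i)) (-k)]
  congr 1
  funext i
  rw [sub_neg_eq_add]

end Twist

end PeriodRingData

end Literature.NumberTheory.GaloisRepresentations
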